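import Literature.MathematicalPhysics.QuantumFieldTheory.OSSkeletonVFunctional
import Literature.Analysis.Distribution.KernelScaling
import Literature.Analysis.FunctionSpaces.SchwartzExchange
import Mathlib.Algebra.BigOperators.Fin
import HarnessLib

/-!
# The skeleton pullback distribution and its regularisations (OS II, Ch. V–VI, Method B: bookkeeping for the pointwise Thm. 4.1)

Topic `Literature/MathematicalPhysics/QuantumFieldTheory`; sequel of `OSSkeletonVFunctional`. For the
pointwise form of Osterwalder–Schrader II, Thm. 4.1/4.1' (real analyticity of the Schwinger functions
in all variables) via the analytic deconvolution lemma
(`Literature.Analysis.Complex.exists_holomorphic_density_of_scaled_regularisations`), the Schwinger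
function `𝔖_{k+2}` must be presented as a tempered distribution `T` on a Euclidean parameter space
whose *regularisations by scaled kernels* are the profile-smeared skeleton Schwinger functions
`𝒮(u) = 𝔖_{k+2}(⊗ⱼ φⱼ(· − pⱼ(u)))` of `OSSkeletonVFunctional` — whose real analyticity with a
holomorphic extension is in the tree (`OSSkeletonVAnalyticity`). This file sets up that
presentation:

* `partialSumEquiv` — the linear automorphism `z ↦ (∑_{i ≤ j} zᵢ)ⱼ` of `Fin (n+1) → M`
  (cumulative positions from increments; inverse: first entry and successive differences);
* the **position map**: parameters `U ∈ ℝ^{(k+2) × d}` (block `0` = coordinates of the first point,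
  block `i+1` = coordinates of the increment of the `i`-th difference, all in the basis `ê`) ↦
  configurations `posLin U ∈ (ℝ^d)^{k+2}`, a continuous linear equivalence (`posLinEquiv`), and the
  affine `posAff U = pbase + posLin U` with `pbase j = ∑_{i<j} ξᵢ`; `posAff_eq_posV` identifies it
  with the positions `pⱼ(u)` of `OSSkeletonVFunctional` translated by the first point;
* `skelPullback` — `Ψ ↦ Ψ ∘ posAff⁻¹` (`𝓢(ℝ^{(k+2)d}) →L 𝓢((ℝ^d)^{k+2})`) and the **skeleton
  distribution** `skelDist 𝔖 = 𝔖_{k+2} ∘ skelPullback`;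
* `skelKernel Φ₀ = Φ₀ ∘ posLin` — the kernel on parameter space attached to a cluster profile
  `Φ₀ ∈ 𝓢((ℝ^d)^{k+2})` (for the skeleton, `Φ₀ = ⊗ⱼ φⱼ`);
* `skelDist_translationAverage_skelKernel` — **the regularisation identity**
  `T(K_{skelKernel Φ₀} Ψ) = ∫ Ψ(U) 𝔖_{k+2}(skeletonFnV Φ₀ (posAff U)) dU`
  (the tree's exchange theorem `SchwartzMap.apply_eq_integral_of_forall_apply_eq_integral`), and
  with `Φ₀ = ⊗ⱼ φⱼ` and translation invariance, `= ∫ Ψ(U) 𝒮(tail U) dU`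
  (`skelDist_translationAverage_tensor`).

## References

* K. Osterwalder, R. Schrader, *Axioms for Euclidean Green's functions II*, Comm. Math. Phys. 42
  (1975) 281–305, Ch. V.1 (5.6)–(5.7), Ch. VI.1 (6.5), (6.8). [OsterwalderSchraderCMP1975]
-/

noncomputable section

open MeasureTheory Set Filter Module
open _root_.Topology
open scoped InnerProductSpace RealInnerProductSpace SchwartzMap

namespace Literature.MathematicalPhysics.QuantumFieldTheory

open Literature.MathematicalPhysics.QuantumLattice (SchwingerFamily)
open Literature.MathematicalPhysics.QuantumLattice.SchwingerFamily
open Literature.Analysis.FunctionSpaces.SchwartzAverage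
open Literature.Analysis.Distribution

/-! ### Cumulative sums as a linear automorphism -/

section PartialSum

variable (R : Type*) {M : Type*} [Semiring R] [AddCommGroup M] [Module R M]

/-- `Fin.partialSum` is additive in the sequence. [folklore] -/
theorem partialSum_add {n : ℕ} (f g : Fin n → M) (j : Fin (n + 1)) :
    Fin.partialSum (f + g) j = Fin.partialSum f j + Fin.partialSum g j := by
  induction j using Fin.induction with
  | zero => simp
  | succ i ih => rw [Fin.partialSum_succ, Fin.partialSum_succ, Fin.partialSum_succ, ih, Pi.add_apply]; abel

/-- `Fin.partialSum` is homogeneous in the sequence. [folklore] -/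
theorem partialSum_smul {n : ℕ} (c : R) (f : Fin n → M) (j : Fin (n + 1)) :
    Fin.partialSum (c • f) j = c • Fin.partialSum f j := by
  induction j using Fin.induction with
  | zero => simp
  | succ i ih => rw [Fin.partialSum_succ, Fin.partialSum_succ, ih, Pi.smul_apply, smul_add]

/-- `Fin.partialSum f j = ∑_{i < j} f i`. [folklore] -/
theorem partialSum_eq_sum_filter {n : ℕ} (f : Fin n → M) (j : Fin (n + 1)) :
    Fin.partialSum f j = ∑ i ∈ Finset.univ.filter (fun i : Fin n => i.val < j.val), f i := by
  induction j using Fin.induction with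
  | zero => simp
  | succ i ih =>
    rw [Fin.partialSum_succ, ih]
    have hset : Finset.univ.filter (fun i' : Fin n => i'.val < (i.succ : Fin (n + 1)).val) =
        insert i (Finset.univ.filter fun i' : Fin n => i'.val < (Fin.castSucc i).val) := by
      ext i'
      simp only [Finset.mem_filter, Finset.mem_univ, true_and, Finset.mem_insert, Fin.val_succ,
        Fin.val_castSucc]
      constructor
      · intro h
        rcases Nat.lt_succ_iff_lt_or_eq.1 h with h' | h'
        · exact Or.inr h'
        · exact Or.inl (Fin.ext h')
      · rintro (rfl | h)
        · exact Nat.lt_succ_self _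
        · exact Nat.lt_succ_of_lt h
    rw [hset, Finset.sum_insert (by simp), add_comm]

/-- **Cumulative sums** `(z₀, z₁, …) ↦ (z₀, z₀ + z₁, z₀ + z₁ + z₂, …)` as a linear automorphism of
`Fin (n+1) → M`; the inverse takes the first entry and the successive differences. [folklore] -/
def partialSumEquiv (n : ℕ) : (Fin (n + 1) → M) ≃ₗ[R] (Fin (n + 1) → M) where
  toFun z j := z 0 + Fin.partialSum (fun i : Fin n => z i.succ) j
  invFun x := Fin.cons (x 0) fun i : Fin n => x i.succ - x (Fin.castSucc i)
  map_add' z z' := by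
    funext j
    simp only [Pi.add_apply]
    rw [show (fun i : Fin n => z i.succ + z' i.succ) = (fun i : Fin n => z i.succ) + fun i => z' i.succ from rfl,
      partialSum_add]
    abel
  map_smul' c z := by
    funext j
    simp only [Pi.smul_apply, RingHom.id_apply, smul_add]
    rw [show (fun i : Fin n => c • z i.succ) = c • fun i : Fin n => z i.succ from rfl, partialSum_smul]
  left_inv z := by
    funext j
    refine Fin.cases ?_ (fun i => ?_) j
    · simp
    · simp only [Fin.cons_succ]
      rw [show (Fin.castSucc i : Fin (n + 1)) = i.castSucc from rfl]
      have h := Fin.partialSum_right_neg (fun i : Fin n => z i.succ) i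
      rw [← sub_eq_neg_add] at h
      rw [add_sub_add_left_eq_sub, h]
  right_inv x := by
    funext j
    have hj := congr_fun (Fin.partialSum_left_neg x) j
    rw [Pi.vadd_apply, vadd_eq_add] at hj
    simp only [Fin.cons_zero, Fin.cons_succ]
    rw [show (fun i : Fin n => x i.succ - x (Fin.castSucc i)) = fun i => -x (Fin.castSucc i) + x i.succ from
      funext fun i => sub_eq_neg_add _ _]
    exact hj

/-- Entries of the cumulative sums: `∑_{i ≤ j}`, written as `z₀ + ∑_{i < j} z_{i+1}`. [folklore] -/
theorem partialSumEquiv_apply (n : ℕ) (z : Fin (n + 1) → M) (j : Fin (n + 1)) :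
    partialSumEquiv R n z j =
      z 0 + ∑ i ∈ Finset.univ.filter (fun i : Fin n => i.val < j.val), z i.succ := by
  change z 0 + Fin.partialSum (fun i : Fin n => z i.succ) j = _
  rw [partialSum_eq_sum_filter]

end PartialSum

/-! ### The position map -/

section Positions

variable {d : ℕ} {k : ℕ} (ξ : Fin (k + 1) → EuclideanSpace ℝ (Fin d))
  (ê : Fin d → EuclideanSpace ℝ (Fin d)) (hli : LinearIndependent ℝ ê)

/-- The basis of `ℝ^d` formed by the `d` linearly independent directions `ê_μ`. [folklore] -/
def dirBasis : Module.Basis (Fin d) ℝ (EuclideanSpace ℝ (Fin d)) :=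
  basisOfLinearIndependentOfCardEqFinrank' ê hli (by simp)

/-- The basis vectors are the directions. [folklore] -/
@[simp]
theorem coe_dirBasis : ⇑(dirBasis ê hli) = ê :=
  coe_basisOfLinearIndependentOfCardEqFinrank' _ _ _

/-- **Coordinates to vectors**: `dirMap c = ∑_μ c_μ ê_μ`, a linear equivalence `ℝ^d ≃ ℝ^d`. [cite: OsterwalderSchraderCMP1975, Ch. V.1 eq. (5.6)] -/
def dirMap : (Fin d → ℝ) ≃ₗ[ℝ] EuclideanSpace ℝ (Fin d) :=
  (dirBasis ê hli).equivFun.symm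

/-- `dirMap c = ∑_μ c_μ ê_μ`. [folklore] -/
theorem dirMap_apply (c : Fin d → ℝ) : dirMap ê hli c = ∑ μ, c μ • ê μ := by
  rw [dirMap, Module.Basis.equivFun_symm_apply, coe_dirBasis]

/-- The blocks of a parameter vector: `U ↦ (j ↦ (μ ↦ U (j, μ)))`. [folklore] -/
def blockEquiv : EuclideanSpace ℝ (Fin (k + 2) × Fin d) ≃ₗ[ℝ] (Fin (k + 2) → Fin d → ℝ) :=
  (WithLp.linearEquiv 2 ℝ (Fin (k + 2) × Fin d → ℝ)).trans (LinearEquiv.curry ℝ ℝ (Fin (k + 2)) (Fin d))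

/-- Entries of the blocks. [folklore] -/
@[simp]
theorem blockEquiv_apply (U : EuclideanSpace ℝ (Fin (k + 2) × Fin d)) (j : Fin (k + 2)) (μ : Fin d) :
    blockEquiv U j μ = U (j, μ) := rfl

/-- **The linear position map** `U ↦ (∑_{i ≤ j} dirMap (U_i))ⱼ`: block `0` is the position of the
first point, block `i + 1` the increment of the `i`-th difference (Osterwalder–Schrader's variables
`u_i^μ` of (5.6), completed by the coordinates of the first point). [cite: OsterwalderSchraderCMP1975, Ch. V.1 eq. (5.6)] -/
def posLinEquiv : EuclideanSpace ℝ (Fin (k + 2) × Fin d) ≃ₗ[ℝ] (Fin (k + 2) → EuclideanSpace ℝ (Fin d)) :=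
  (blockEquiv.trans (LinearEquiv.piCongrRight fun _ : Fin (k + 2) => dirMap ê hli)).trans
    (partialSumEquiv ℝ (k + 1))

/-- Entries of the linear position map. [folklore] -/
theorem posLinEquiv_apply (U : EuclideanSpace ℝ (Fin (k + 2) × Fin d)) (j : Fin (k + 2)) :
    posLinEquiv ê hli U j = dirMap ê hli (fun μ => U (0, μ)) +
      ∑ i ∈ Finset.univ.filter (fun i : Fin (k + 1) => i.val < j.val), dirMap ê hli fun μ => U (i.succ, μ) := by
  rw [posLinEquiv, LinearEquiv.trans_apply, partialSumEquiv_apply]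
  rfl

/-- The linear position map as a continuous linear equivalence. [folklore] -/
def posLinCLE : EuclideanSpace ℝ (Fin (k + 2) × Fin d) ≃L[ℝ] (Fin (k + 2) → EuclideanSpace ℝ (Fin d)) :=
  (posLinEquiv ê hli).toContinuousLinearEquiv

/-- The continuous linear equivalence is the linear position map. [folklore] -/
@[simp]
theorem posLinCLE_apply (U : EuclideanSpace ℝ (Fin (k + 2) × Fin d)) : posLinCLE ê hli U = posLinEquiv ê hli U := rfl

/-- **The base configuration** `pbase j = ∑_{i<j} ξᵢ` (first point at the origin). [cite: OsterwalderSchraderCMP1975, Ch. V.1 eq. (5.7)] -/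
def pbase (j : Fin (k + 2)) : EuclideanSpace ℝ (Fin d) :=
  ∑ i ∈ Finset.univ.filter (fun i : Fin (k + 1) => i.val < j.val), ξ i

/-- **The affine position map** `posAff U = pbase + posLin U`. [cite: OsterwalderSchraderCMP1975, Ch. V.1 eq. (5.7)] -/
def posAff (U : EuclideanSpace ℝ (Fin (k + 2) × Fin d)) : Fin (k + 2) → EuclideanSpace ℝ (Fin d) :=
  pbase ξ + posLinCLE ê hli U

/-- The tail blocks `(i, μ) ↦ U (i+1, μ)`: the directional variables of `OSSkeletonVFunctional`. [folklore] -/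
def tailBlocks (U : EuclideanSpace ℝ (Fin (k + 2) × Fin d)) : Fin (k + 1) × Fin d → ℝ :=
  fun p => U (p.1.succ, p.2)

/-- **The affine positions are the positions of `OSSkeletonVFunctional`, translated by the first
point**: `posAff U j = dirMap (U₀) + pⱼ(tail U)`. [folklore] -/
theorem posAff_eq_posV (U : EuclideanSpace ℝ (Fin (k + 2) × Fin d)) (j : Fin (k + 2)) :
    posAff ξ ê hli U j = posV ξ ê (tailBlocks U) j + dirMap ê hli (fun μ => U (0, μ)) := by
  rw [posAff, Pi.add_apply, posLinCLE_apply, posLinEquiv_apply, pbase, posV]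
  simp_rw [dirDiff, dirMap_apply, tailBlocks]
  rw [Finset.sum_add_distrib]
  abel

/-- Continuity of the affine position map. [folklore] -/
theorem continuous_posAff : Continuous (posAff ξ ê hli) :=
  continuous_const.add (posLinCLE ê hli).continuous

/-- The operator norm of the linear position map. [folklore] -/
def posLinNorm (k : ℕ) : ℝ := ‖(posLinCLE (k := k) ê hli).toContinuousLinearMap‖

/-- `posLinNorm` is nonnegative. [folklore] -/
theorem posLinNorm_nonneg (k : ℕ) : 0 ≤ posLinNorm ê hli k := norm_nonneg _

/-- The linear position map is bounded by its operator norm. [folklore] -/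
theorem norm_posLinCLE_le (U : EuclideanSpace ℝ (Fin (k + 2) × Fin d)) :
    ‖posLinCLE ê hli U‖ ≤ posLinNorm ê hli k * ‖U‖ :=
  (posLinCLE ê hli).toContinuousLinearMap.le_opNorm U

/-- Affine bound of the positions. [folklore] -/
theorem norm_posAff_le (U : EuclideanSpace ℝ (Fin (k + 2) × Fin d)) :
    ‖posAff ξ ê hli U‖ ≤ ‖pbase ξ‖ + posLinNorm ê hli k * ‖U‖ :=
  (norm_add_le _ _).trans (add_le_add le_rfl (norm_posLinCLE_le ê hli U))

end Positions

/-! ### The skeleton distribution and kernels -/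

section Dist

variable {d : ℕ} {k : ℕ} (𝔖 : SchwingerFamily (EuclideanSpace ℝ (Fin d)))
  (ξ : Fin (k + 1) → EuclideanSpace ℝ (Fin d))
  (ê : Fin d → EuclideanSpace ℝ (Fin d)) (hli : LinearIndependent ℝ ê)

/-- **The skeleton pullback** `Ψ ↦ Ψ ∘ posAff⁻¹` (`𝓢(ℝ^{(k+2)d}) →L 𝓢((ℝ^d)^{k+2})`). [folklore] -/
def skelPullback : 𝓢(EuclideanSpace ℝ (Fin (k + 2) × Fin d), ℂ) →L[ℂ]
    𝓢((Fin (k + 2) → EuclideanSpace ℝ (Fin d)), ℂ) :=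
  (SchwartzMap.compSubConstCLM ℂ (pbase ξ)).comp
    (SchwartzMap.compCLMOfContinuousLinearEquiv ℂ (posLinCLE ê hli).symm)

/-- Values of the pullback: `(skelPullback Ψ)(x) = Ψ(posLin⁻¹(x − pbase))`. [folklore] -/
@[simp]
theorem skelPullback_apply (Ψ : 𝓢(EuclideanSpace ℝ (Fin (k + 2) × Fin d), ℂ))
    (x : Fin (k + 2) → EuclideanSpace ℝ (Fin d)) :
    skelPullback ξ ê hli Ψ x = Ψ ((posLinCLE ê hli).symm (x - pbase ξ)) := rfl

/-- **The skeleton distribution** `T = 𝔖_{k+2} ∘ skelPullback` on the parameter space. [cite: OsterwalderSchraderCMP1975, Ch. VI.1 eq. (6.5)] -/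
def skelDist : 𝓢(EuclideanSpace ℝ (Fin (k + 2) × Fin d), ℂ) →L[ℂ] ℂ :=
  (𝔖 (k + 2)).comp (skelPullback ξ ê hli)

/-- Values of the skeleton distribution. [folklore] -/
theorem skelDist_apply (Ψ : 𝓢(EuclideanSpace ℝ (Fin (k + 2) × Fin d), ℂ)) :
    skelDist 𝔖 ξ ê hli Ψ = 𝔖 (k + 2) (skelPullback ξ ê hli Ψ) := rfl

/-- **The kernel of a cluster profile** `Φ₀ ∈ 𝓢((ℝ^d)^{k+2})`: `skelKernel Φ₀ = Φ₀ ∘ posLin`. [cite: OsterwalderSchraderCMP1975, Ch. VI.1 eq. (6.5)] -/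
def skelKernel (Φ₀ : 𝓢((Fin (k + 2) → EuclideanSpace ℝ (Fin d)), ℂ)) :
    𝓢(EuclideanSpace ℝ (Fin (k + 2) × Fin d), ℂ) :=
  SchwartzMap.compCLMOfContinuousLinearEquiv ℂ (posLinCLE ê hli) Φ₀

/-- Values of the kernel. [folklore] -/
@[simp]
theorem skelKernel_apply (Φ₀ : 𝓢((Fin (k + 2) → EuclideanSpace ℝ (Fin d)), ℂ))
    (U : EuclideanSpace ℝ (Fin (k + 2) × Fin d)) :
    skelKernel ê hli Φ₀ U = Φ₀ (posLinCLE ê hli U) := rfl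

/-- **The pulled-back regularisation is a superposition of skeleton clusters**:
`skelPullback (K_{skelKernel Φ₀} Ψ)(x) = ∫ Ψ(U) (skeletonFnV Φ₀ (posAff U))(x) dU`
(the substitution `a = posLin⁻¹(x − pbase) − U` in `∫ Φ₀(posLin a) Ψ(· − a) da`). [folklore] -/
theorem skelPullback_translationAverage_skelKernel_apply
    (Φ₀ : 𝓢((Fin (k + 2) → EuclideanSpace ℝ (Fin d)), ℂ))
    (Ψ : 𝓢(EuclideanSpace ℝ (Fin (k + 2) × Fin d), ℂ)) (x : Fin (k + 2) → EuclideanSpace ℝ (Fin d)) :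
    skelPullback ξ ê hli (translationAverage (ContinuousLinearMap.id ℝ _) (skelKernel ê hli Φ₀) Ψ) x =
      ∫ U : EuclideanSpace ℝ (Fin (k + 2) × Fin d), Ψ U * skeletonFnV Φ₀ (posAff ξ ê hli U) x := by
  rw [skelPullback_apply, translationAverage_id_apply]
  set w : EuclideanSpace ℝ (Fin (k + 2) × Fin d) := (posLinCLE ê hli).symm (x - pbase ξ) with hw
  rw [← integral_sub_left_eq_self _ volume w]
  refine integral_congr_ae (Eventually.of_forall fun U => ?_)
  change skelKernel ê hli Φ₀ (w - U) * Ψ (w - (w - U)) = Ψ U * skeletonFnV Φ₀ (posAff ξ ê hli U) x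
  rw [sub_sub_cancel, mul_comm, skelKernel_apply, skeletonFnV_apply]
  congr 1
  have h : posLinCLE ê hli (w - U) = x - posAff ξ ê hli U := by
    rw [map_sub, hw, ContinuousLinearEquiv.apply_symm_apply, posAff]
    abel
  rw [h]
  rfl

/-- Seminorm growth of the family of skeleton clusters along the affine positions. [folklore] -/
theorem seminorm_skeletonFnV_posAff_le (Φ₀ : 𝓢((Fin (k + 2) → EuclideanSpace ℝ (Fin d)), ℂ)) (m n : ℕ)
    (U : EuclideanSpace ℝ (Fin (k + 2) × Fin d)) :
    SchwartzMap.seminorm ℂ m n (skeletonFnV Φ₀ (posAff ξ ê hli U)) ≤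
      (2 ^ m * (1 + ‖pbase ξ‖ + posLinNorm ê hli k) ^ m *
        (SchwartzMap.seminorm ℂ m n Φ₀ + SchwartzMap.seminorm ℂ 0 n Φ₀)) * (1 + ‖U‖) ^ m := by
  refine (seminorm_skeletonFnV_le Φ₀ m n _).trans ?_
  have hP : 1 + ‖posAff ξ ê hli U‖ ≤ (1 + ‖pbase ξ‖ + posLinNorm ê hli k) * (1 + ‖U‖) := by
    have h := norm_posAff_le ξ ê hli U
    have h0 : 0 ≤ ‖pbase ξ‖ := norm_nonneg _
    have h1 : 0 ≤ posLinNorm ê hli k := posLinNorm_nonneg ê hli k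
    nlinarith [norm_nonneg U, mul_nonneg h1 (norm_nonneg U)]
  have hS : 0 ≤ SchwartzMap.seminorm ℂ m n Φ₀ + SchwartzMap.seminorm ℂ 0 n Φ₀ := by positivity
  calc 2 ^ m * (1 + ‖posAff ξ ê hli U‖) ^ m * (SchwartzMap.seminorm ℂ m n Φ₀ + SchwartzMap.seminorm ℂ 0 n Φ₀)
      ≤ 2 ^ m * ((1 + ‖pbase ξ‖ + posLinNorm ê hli k) * (1 + ‖U‖)) ^ m *
          (SchwartzMap.seminorm ℂ m n Φ₀ + SchwartzMap.seminorm ℂ 0 n Φ₀) := by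
        gcongr
    _ = (2 ^ m * (1 + ‖pbase ξ‖ + posLinNorm ê hli k) ^ m *
          (SchwartzMap.seminorm ℂ m n Φ₀ + SchwartzMap.seminorm ℂ 0 n Φ₀)) * (1 + ‖U‖) ^ m := by
        rw [mul_pow]; ring

/-- **The regularisation identity**: the skeleton distribution regularised by the kernel of a
cluster profile is the superposition of the Schwinger functions of the skeleton clusters,
`T(K_{skelKernel Φ₀} Ψ) = ∫ Ψ(U) 𝔖_{k+2}(skeletonFnV Φ₀ (posAff U)) dU` (the tree's exchange
theorem for tempered distributions). [cite: OsterwalderSchraderCMP1975, Ch. VI.1 eqs. (6.5), (6.8)] -/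
theorem skelDist_translationAverage_skelKernel (Φ₀ : 𝓢((Fin (k + 2) → EuclideanSpace ℝ (Fin d)), ℂ))
    (Ψ : 𝓢(EuclideanSpace ℝ (Fin (k + 2) × Fin d), ℂ)) :
    skelDist 𝔖 ξ ê hli (translationAverage (ContinuousLinearMap.id ℝ _) (skelKernel ê hli Φ₀) Ψ) =
      ∫ U : EuclideanSpace ℝ (Fin (k + 2) × Fin d), Ψ U * 𝔖 (k + 2) (skeletonFnV Φ₀ (posAff ξ ê hli U)) := by
  rw [skelDist_apply]
  refine SchwartzMap.apply_eq_integral_of_forall_apply_eq_integral (𝔖 (k + 2))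
    (fun U => skeletonFnV Φ₀ (posAff ξ ê hli U)) ((continuous_skeletonFnV Φ₀).comp (continuous_posAff ξ ê hli))
    (fun m n => ⟨_, m, fun U => seminorm_skeletonFnV_posAff_le ξ ê hli Φ₀ m n U⟩) Ψ Ψ.continuous
    (fun N => Ψ.integrable_one_add_norm_pow_mul N) _ fun x => ?_
  exact skelPullback_translationAverage_skelKernel_apply ξ ê hli Φ₀ Ψ x

/-- **For the skeleton cluster `⊗ⱼ φⱼ`** and a translation-invariant `𝔖`, the regularisation is the
superposition of the directional skeleton Schwinger function of `OSSkeletonVFunctional`: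
`T(K_{skelKernel (⊗φ)} Ψ) = ∫ Ψ(U) 𝒮(tail U) dU`. [cite: OsterwalderSchraderCMP1975, Ch. VI.1 eq. (6.8)] -/
theorem skelDist_translationAverage_tensor (hE1 : 𝔖.IsEuclideanCovariant)
    (φ : Fin (k + 2) → 𝓢(EuclideanSpace ℝ (Fin d), ℂ))
    (Ψ : 𝓢(EuclideanSpace ℝ (Fin (k + 2) × Fin d), ℂ)) :
    skelDist 𝔖 ξ ê hli (translationAverage (ContinuousLinearMap.id ℝ _)
        (skelKernel ê hli (SchwartzMap.tensorFin (k + 2) φ)) Ψ) =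
      ∫ U : EuclideanSpace ℝ (Fin (k + 2) × Fin d), Ψ U * skelSV 𝔖 φ ξ ê (tailBlocks U) := by
  rw [skelDist_translationAverage_skelKernel]
  refine integral_congr_ae (Eventually.of_forall fun U => ?_)
  simp only [skelSV]
  congr 1
  have h : posAff ξ ê hli U = fun j => posV ξ ê (tailBlocks U) j + dirMap ê hli fun μ => U (0, μ) :=
    funext fun j => posAff_eq_posV ξ ê hli U j
  rw [h, ← schwinger_skeletonFnV_add_const hE1]

end Dist

/-! ### The kernel family of the skeleton profiles and its binary splitting -/

section Family

variable {d : ℕ} {k : ℕ} (ê : Fin d → EuclideanSpace ℝ (Fin d)) (hli : LinearIndependent ℝ ê)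

/-- **The dual direction** `w_ν ∈ ℝ^d` representing the `ν`-th coordinate in the basis `ê`:
`⟪y, w_ν⟫ = (coordinate of y along ê_ν)`. [folklore] -/
def dualDir (ν : Fin d) : EuclideanSpace ℝ (Fin d) :=
  (InnerProductSpace.toDual ℝ (EuclideanSpace ℝ (Fin d))).symm
    (LinearMap.toContinuousLinearMap ((dirBasis ê hli).coord ν))

/-- The dual direction computes the coordinate: `⟪y, w_ν⟫ = repr y ν`. [folklore] -/
theorem inner_dualDir (y : EuclideanSpace ℝ (Fin d)) (ν : Fin d) :
    ⟪y, dualDir ê hli ν⟫ = (dirBasis ê hli).repr y ν := by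
  rw [dualDir, real_inner_comm, InnerProductSpace.toDual_symm_apply]
  rfl

/-- Coordinates of `dirMap c` are `c`. [folklore] -/
theorem repr_dirMap (c : Fin d → ℝ) (ν : Fin d) : (dirBasis ê hli).repr (dirMap ê hli c) ν = c ν := by
  have h : (dirBasis ê hli).equivFun (dirMap ê hli c) = c := by
    rw [dirMap, LinearEquiv.apply_symm_apply]
  have h' := congr_fun h ν
  rwa [Module.Basis.equivFun_apply] at h'

/-- **The kernel family of the skeleton profiles**: index `(c, φ⃗) ∈ ℂ × 𝒮(ℝ^d)^{k+2}`, kernel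
`c · skelKernel (⊗ⱼ φⱼ)`. The scalar allows signs and the zero kernel in the binary splitting. [folklore] -/
def skelFamily (a : ℂ × (Fin (k + 2) → 𝓢(EuclideanSpace ℝ (Fin d), ℂ))) :
    𝓢(EuclideanSpace ℝ (Fin (k + 2) × Fin d), ℂ) :=
  a.1 • skelKernel ê hli (SchwartzMap.tensorFin (k + 2) a.2)

/-- Values of the kernels of the family. [folklore] -/
theorem skelFamily_apply (a : ℂ × (Fin (k + 2) → 𝓢(EuclideanSpace ℝ (Fin d), ℂ)))
    (U : EuclideanSpace ℝ (Fin (k + 2) × Fin d)) :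
    skelFamily ê hli a U = a.1 * ∏ j, a.2 j (posLinCLE ê hli U j) := by
  rw [skelFamily, smul_apply, smul_eq_mul, skelKernel_apply, SchwartzMap.tensorFin_apply]

/-- **The binary splitting** of the family under multiplication by the coordinate `(i, ν)`:
for `i = j + 1` the coordinate is `coord_ν(z_{j+1} - z_j)` in the positions `z = posLin U`, which
multiplies the profile of the point `j + 1` by `⟪·, w_ν⟫` (first summand) minus the same for the
point `j` (second summand, with the opposite scalar); for `i = 0` it is `coord_ν(z₀)` (second
summand the zero kernel). [folklore] -/
def skelSplit (p : Fin (k + 2) × Fin d) (a : ℂ × (Fin (k + 2) → 𝓢(EuclideanSpace ℝ (Fin d), ℂ))) :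
    (ℂ × (Fin (k + 2) → 𝓢(EuclideanSpace ℝ (Fin d), ℂ))) × (ℂ × (Fin (k + 2) → 𝓢(EuclideanSpace ℝ (Fin d), ℂ))) :=
  ((a.1, Function.update a.2 p.1 (coordMul (dualDir ê hli p.2) (a.2 p.1))),
    Fin.cases (motive := fun _ => ℂ × (Fin (k + 2) → 𝓢(EuclideanSpace ℝ (Fin d), ℂ)))
      ((0 : ℂ), a.2)
      (fun j => (-a.1, Function.update a.2 (Fin.castSucc j) (coordMul (dualDir ê hli p.2) (a.2 (Fin.castSucc j)))))
      p.1)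

/-- **The product of the profiles with one of them multiplied by a coordinate**:
`∏ⱼ (update φ i (⟪·, c⟫ φᵢ))ⱼ(zⱼ) = ⟪zᵢ, c⟫ ∏ⱼ φⱼ(zⱼ)`. [folklore] -/
theorem prod_update_coordMul_apply (φ : Fin (k + 2) → 𝓢(EuclideanSpace ℝ (Fin d), ℂ)) (i : Fin (k + 2))
    (c : EuclideanSpace ℝ (Fin d)) (z : Fin (k + 2) → EuclideanSpace ℝ (Fin d)) :
    ∏ j, Function.update φ i (coordMul c (φ i)) j (z j) = ((⟪z i, c⟫ : ℝ) : ℂ) * ∏ j, φ j (z j) := by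
  have h1 : (fun j => Function.update φ i (coordMul c (φ i)) j (z j)) =
      Function.update (fun j => φ j (z j)) i (coordMul c (φ i) (z i)) := by
    funext j
    by_cases hj : j = i
    · subst hj; simp
    · simp [Function.update_of_ne hj]
  rw [show ∏ j, Function.update φ i (coordMul c (φ i)) j (z j) =
      ∏ j, (fun j => Function.update φ i (coordMul c (φ i)) j (z j)) j from rfl, h1,
    Finset.prod_update_of_mem (Finset.mem_univ i), Finset.sdiff_singleton_eq_erase, coordMul_apply, mul_assoc,
    Finset.mul_prod_erase Finset.univ (fun j => φ j (z j)) (Finset.mem_univ i)]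

/-- The coordinate `(i, ν)` of `U` through the positions `z = posLin U`:
block `0`: `coord_ν(z₀)`; block `j + 1`: `coord_ν(z_{j+1}) − coord_ν(z_j)`. [folklore] -/
theorem coord_eq_repr_posLin (U : EuclideanSpace ℝ (Fin (k + 2) × Fin d)) (ν : Fin d) :
    (U (0, ν) = (dirBasis ê hli).repr (posLinCLE ê hli U 0) ν) ∧
      ∀ j : Fin (k + 1), U (j.succ, ν) =
        (dirBasis ê hli).repr (posLinCLE ê hli U j.succ) ν - (dirBasis ê hli).repr (posLinCLE ê hli U (Fin.castSucc j)) ν := by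
  constructor
  · rw [posLinCLE_apply, posLinEquiv_apply]
    simp [repr_dirMap]
  · intro j
    rw [posLinCLE_apply, posLinEquiv_apply, posLinEquiv_apply, map_add, map_add, map_sum, map_sum]
    simp only [Finsupp.coe_add, Pi.add_apply, Finsupp.coe_finsetSum, Finset.sum_apply, repr_dirMap]
    have hset : Finset.univ.filter (fun i' : Fin (k + 1) => i'.val < (j.succ : Fin (k + 2)).val) =
        insert j (Finset.univ.filter fun i' : Fin (k + 1) => i'.val < (Fin.castSucc j : Fin (k + 2)).val) := by
      ext i'
      simp only [Finset.mem_filter, Finset.mem_univ, true_and, Finset.mem_insert, Fin.val_succ,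
        Fin.val_castSucc]
      constructor
      · intro h
        rcases Nat.lt_succ_iff_lt_or_eq.1 h with h' | h'
        · exact Or.inr h'
        · exact Or.inl (Fin.ext h')
      · rintro (rfl | h)
        · exact Nat.lt_succ_self _
        · exact Nat.lt_succ_of_lt h
    rw [hset, Finset.sum_insert (by simp)]
    ring

/-- **The binary splitting identity**: multiplication of a kernel of the family by the coordinate
`(i, ν)` (`coordMul` along the standard basis vector of the parameter space) is the sum of the two
kernels of `skelSplit`. [folklore] -/
theorem coordMul_skelFamily (p : Fin (k + 2) × Fin d) (a : ℂ × (Fin (k + 2) → 𝓢(EuclideanSpace ℝ (Fin d), ℂ))) :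
    coordMul (EuclideanSpace.single p (1 : ℝ)) (skelFamily ê hli a) =
      skelFamily ê hli (skelSplit ê hli p a).1 + skelFamily ê hli (skelSplit ê hli p a).2 := by
  obtain ⟨i, ν⟩ := p
  obtain ⟨c, φ⟩ := a
  ext U
  rw [coordMul_apply, add_apply, EuclideanSpace.inner_single_right]
  simp only [one_mul, conj_trivial]
  obtain ⟨h0, hsucc⟩ := coord_eq_repr_posLin ê hli U ν
  refine Fin.cases ?_ (fun j => ?_) i
  · -- block `0`
    simp only [skelSplit, Fin.cases_zero, skelFamily_apply, zero_mul, add_zero]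
    rw [prod_update_coordMul_apply, inner_dualDir, ← h0]
    ring
  · -- block `j + 1`
    simp only [skelSplit, Fin.cases_succ, skelFamily_apply]
    rw [prod_update_coordMul_apply, prod_update_coordMul_apply, inner_dualDir, inner_dualDir, hsucc j]
    push_cast
    ring

/-- **Supports of the kernels of the family**: if every profile is supported in `B̄(0, r)` then the
kernel is supported in `B̄(0, ‖posLin⁻¹‖ r)`. [folklore] -/
theorem tsupport_skelFamily_subset {r : ℝ} (hr : 0 ≤ r) (a : ℂ × (Fin (k + 2) → 𝓢(EuclideanSpace ℝ (Fin d), ℂ)))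
    (hφ : ∀ j, tsupport (a.2 j : EuclideanSpace ℝ (Fin d) → ℂ) ⊆ Metric.closedBall 0 r) :
    tsupport (skelFamily ê hli a : EuclideanSpace ℝ (Fin (k + 2) × Fin d) → ℂ) ⊆
      Metric.closedBall 0 (‖((posLinCLE (k := k) ê hli).symm).toContinuousLinearMap‖ * r) := by
  refine closure_minimal (fun U hU => ?_) Metric.isClosed_closedBall
  rw [Function.mem_support, skelFamily_apply] at hU
  have hz : ∀ j, ‖posLinCLE ê hli U j‖ ≤ r := fun j => by
    by_contra h
    push Not at h
    have hzero : a.2 j (posLinCLE ê hli U j) = 0 := by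
      refine image_eq_zero_of_notMem_tsupport fun hmem => ?_
      have := hφ j hmem
      rw [Metric.mem_closedBall, dist_zero_right] at this
      linarith
    exact hU (by rw [Finset.prod_eq_zero (Finset.mem_univ j) hzero, mul_zero])
  have hzn : ‖posLinCLE ê hli U‖ ≤ r := (pi_norm_le_iff_of_nonneg hr).2 hz
  rw [Metric.mem_closedBall, dist_zero_right]
  calc ‖U‖ = ‖(posLinCLE ê hli).symm (posLinCLE ê hli U)‖ := by rw [ContinuousLinearEquiv.symm_apply_apply]
    _ ≤ ‖((posLinCLE (k := k) ê hli).symm).toContinuousLinearMap‖ * ‖posLinCLE ê hli U‖ :=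
        ((posLinCLE ê hli).symm).toContinuousLinearMap.le_opNorm _
    _ ≤ ‖((posLinCLE (k := k) ê hli).symm).toContinuousLinearMap‖ * r :=
        mul_le_mul_of_nonneg_left hzn (norm_nonneg _)

/-- The profiles of the split kernels keep their supports. [folklore] -/
theorem tsupport_skelSplit_subset {r : ℝ} (p : Fin (k + 2) × Fin d)
    (a : ℂ × (Fin (k + 2) → 𝓢(EuclideanSpace ℝ (Fin d), ℂ)))
    (hφ : ∀ j, tsupport (a.2 j : EuclideanSpace ℝ (Fin d) → ℂ) ⊆ Metric.closedBall 0 r) :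
    (∀ j, tsupport ((skelSplit ê hli p a).1.2 j : EuclideanSpace ℝ (Fin d) → ℂ) ⊆ Metric.closedBall 0 r) ∧
      ∀ j, tsupport ((skelSplit ê hli p a).2.2 j : EuclideanSpace ℝ (Fin d) → ℂ) ⊆ Metric.closedBall 0 r := by
  have hupd : ∀ (i : Fin (k + 2)) (c : EuclideanSpace ℝ (Fin d)) (j : Fin (k + 2)),
      tsupport (Function.update a.2 i (coordMul c (a.2 i)) j : EuclideanSpace ℝ (Fin d) → ℂ) ⊆
        Metric.closedBall 0 r := by
    intro i c j
    by_cases hj : j = i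
    · subst hj
      rw [Function.update_self]
      exact (tsupport_coordMul_subset c _).trans (hφ j)
    · rw [Function.update_of_ne hj]
      exact hφ j
  constructor
  · intro j; exact hupd _ _ j
  · obtain ⟨i, ν⟩ := p
    refine Fin.cases ?_ (fun i' => ?_) i
    · intro j; simpa [skelSplit] using hφ j
    · intro j; simpa [skelSplit] using hupd _ _ j

end Family

end Literature.MathematicalPhysics.QuantumFieldTheory
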